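import Summits.CriticalPhenomena.PercolationContinuityZ3.Theses.PercNearOneGluing
import Literature.Probability.Percolation.KozmaNitzanPinning
import Literature.Probability.Percolation.LongRangeKernelPercolationProofs
import Literature.Probability.Percolation.PercolationProofs

/-!
# `NoHeavyLowerTail` (crux stmt-CriticalPhenomena-4575 ≡ KN Conjecture 3): kernel/compiler-checked
# small-graph certificates of its finitely-checkable linear forms (compute-cert seat)

The crux is an `ε–δ` statement over ALL finite weighted graphs, so no finite computation settles it;
what a computation CAN certify are its finitely-refutable linear forms on finite windows
(Disproof.lean §D.1: any constant in the linear lower-tail form gives the crux; `AdditiveGluing` gives `C = 3`).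
This file makes the window `n = 4`, uniform weight `1/2` on an arbitrary loopless edge set `E ⊆ Sym2 (Fin 4)`
(the `HalfWeightReduction` normal form; all 64 labelled = 11 unlabelled graphs) a LEAN THEOREM:

* `real_halfOn_eq_card_div` — COUNTING NORMAL FORM (the checker): for the weight `1/2` on `E` and `0` off `E`,
  `P(B) = #{T ⊆ E : ↑T ∈ B} / 2^|E|` for every event `B` (bridge = the tree's cylinder decomposition
  `prodBernoulli_real_eq_sum_localCylinder` + `prodBernoulli_real_localCylinder`).
* `agCount_fin4`, `lowerTailCount_fin4`, `hubTailCount_fin4` — the three integer certificates, proved by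
  `native_decide` through Mathlib's decidable `SimpleGraph.Reachable` on `fromEdgeSet ↑T` (computational facts;
  re-elaborate in < 60 s). They restate, over all `(E, A, o, b)`:
    AG   `#{o ↔ A, o ↮ b} ≤ max_{a ∈ A} #{a ↮ b}`                         (AdditiveGluing 4576, instance-wise)
    LIN  `#{1 ≤ N, 2N ≤ |A|} ≤ #{o ↮ A} + max_{a,a' ∈ A} #{a ↮ a'}`       (linear lower tail, C = 1, N = |C(o) ∩ A|)
    HUB  `#{o ↮ a₀, 1 ≤ N', 2N' ≤ |A|} ≤ max_{a ∈ A} #{a ↮ a₀}`           (hub form, N' = |C(o) ∩ (A ∖ a₀)|)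
* `gluingDefect_le_fin4`, `additiveGluing_fin4` (the route's `AdditiveGluing` VERBATIM on this window),
  `lowerTail_le_fin4`, `hubTail_le_fin4` — the measure-level statements for `prodBernoulli`.

The exhaustive exact sweeps behind the choice of forms and constants (all graphs `n ≤ 8` at weight 1/2, all weighted
graphs `n ≤ 6` on coarse weight grids; sup of every ratio < 1 or = 1 only at degenerate gluing) are kit jobs attached to
the item as evidence (kit compute job j018359); this file does NOT refute or prove the crux.
-/

noncomputable section

namespace Summit.CriticalPhenomena.PercolationContinuityZ3.Theorems.NoHeavyLowerTail.Negative

open MeasureTheory Set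
open Literature.Probability.LatticeModels Literature.Probability.Percolation

/-! ### The counting normal form at weight `1/2` -/

/-- The weight function of the window: `1/2` on `E`, `0` off `E`. (Written inline everywhere below; this
abbreviation-free lemma records its two values.) -/
theorem coe_halfOn_apply {n : ℕ} (E : Finset (Sym2 (Fin n))) (e : Sym2 (Fin n)) :
    (((fun e => if e ∈ E then half else 0 : Sym2 (Fin n) → unitInterval) e : unitInterval) : ℝ) =
      if e ∈ E then 1 / 2 else 0 := by
  by_cases h : e ∈ E <;> simp [h]

/-- Every event of configurations on a finite index type is determined by all coordinates. -/
theorem determinedBy_coe_univ {n : ℕ} (B : Set (BondConfig (Fin n))) :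
    DeterminedBy B (↑(Finset.univ : Finset (Sym2 (Fin n))) : Set (Sym2 (Fin n))) := by
  rw [Finset.coe_univ, determinedBy_iff]
  intro ω ω' h
  rw [Set.inter_univ, Set.inter_univ] at h
  rw [h]

open Classical in
/-- **Counting normal form (the checker).** Under the weight `1/2` on `E` and `0` off `E`, the probability of
ANY event `B` is the number of sub-configurations `T ⊆ E` lying in `B`, divided by `2^|E|`. [folklore] -/
theorem real_halfOn_eq_card_div {n : ℕ} (E : Finset (Sym2 (Fin n))) (B : Set (BondConfig (Fin n))) :
    (prodBernoulli (fun e => if e ∈ E then half else 0 : Sym2 (Fin n) → unitInterval)).real B =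
      ((E.powerset.filter fun T : Finset (Sym2 (Fin n)) => (↑T : Set (Sym2 (Fin n))) ∈ B).card : ℝ) /
        2 ^ E.card := by
  set w : Sym2 (Fin n) → unitInterval := fun e => if e ∈ E then half else 0 with hw
  rw [prodBernoulli_real_eq_sum_localCylinder w Finset.univ (determinedBy_coe_univ B)]
  have hterm : ∀ T : Finset (Sym2 (Fin n)),
      (prodBernoulli w).real (localCylinder ↑(Finset.univ : Finset (Sym2 (Fin n))) ↑T) =
        if T ⊆ E then (1 / 2 : ℝ) ^ E.card else 0 := by
    intro T
    rw [prodBernoulli_real_localCylinder]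
    by_cases hT : T ⊆ E
    · rw [if_pos hT, ← Finset.prod_mul_prod_compl E]
      refine Eq.trans (b := (∏ _i ∈ E, (1 / 2 : ℝ)) * ∏ _i ∈ Eᶜ, (1 : ℝ)) ?_ ?_
      · congr 1
        · refine Finset.prod_congr rfl fun i hi => ?_
          have hwi : (w i : ℝ) = 1 / 2 := by rw [hw, coe_halfOn_apply, if_pos hi]
          split_ifs
          · rw [hwi]
          · rw [hwi]; norm_num
        · refine Finset.prod_congr rfl fun i hi => ?_
          have hiE : i ∉ E := Finset.mem_compl.1 hi
          have hiT : i ∉ (↑T : Set (Sym2 (Fin n))) := fun h => hiE (hT (Finset.mem_coe.1 h))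
          have hwi : (w i : ℝ) = 0 := by rw [hw, coe_halfOn_apply, if_neg hiE]
          rw [if_neg hiT, hwi, sub_zero]
      · rw [Finset.prod_const, Finset.prod_const_one, mul_one]
    · rw [if_neg hT]
      obtain ⟨i, hiT, hiE⟩ := Finset.not_subset.1 hT
      refine Finset.prod_eq_zero (Finset.mem_univ i) ?_
      have : (w i : ℝ) = 0 := by rw [hw, coe_halfOn_apply, if_neg hiE]
      rw [if_pos (Finset.mem_coe.2 hiT), this]
  simp_rw [hterm]
  rw [Finset.sum_ite, Finset.sum_const_zero, add_zero, Finset.sum_const, nsmul_eq_mul]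
  have hsets : ((Finset.univ : Finset (Sym2 (Fin n))).powerset.filter
        (fun T : Finset (Sym2 (Fin n)) => (↑T : Set (Sym2 (Fin n))) ∈ B)).filter (fun T => T ⊆ E) =
      E.powerset.filter fun T : Finset (Sym2 (Fin n)) => (↑T : Set (Sym2 (Fin n))) ∈ B := by
    ext T
    simp only [Finset.mem_filter, Finset.mem_powerset, Finset.subset_univ, true_and]
    exact and_comm
  rw [hsets, one_div, inv_pow, div_eq_mul_inv]

open Classical in
/-- Counting normal form with the count read through any decidable predicate `P` equivalent to membership in `B`
(this is the form the `native_decide` certificates below are stated in). [folklore] -/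
theorem real_halfOn_eq_card_div' {n : ℕ} (E : Finset (Sym2 (Fin n))) (B : Set (BondConfig (Fin n)))
    (P : Finset (Sym2 (Fin n)) → Prop) [DecidablePred P]
    (hP : ∀ T : Finset (Sym2 (Fin n)), (↑T : Set (Sym2 (Fin n))) ∈ B ↔ P T) :
    (prodBernoulli (fun e => if e ∈ E then half else 0 : Sym2 (Fin n) → unitInterval)).real B =
      ((E.powerset.filter P).card : ℝ) / 2 ^ E.card := by
  rw [real_halfOn_eq_card_div E B, Finset.filter_congr (fun T _ => hP T)]

/-! ### Reading events on a finite configuration `↑T` as decidable reachability predicates -/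

/-- `↑T ∈ {x ↔ y}` iff `x, y` are joined in `fromEdgeSet ↑T` (definitional). -/
theorem coe_mem_openConn_iff {n : ℕ} (T : Finset (Sym2 (Fin n))) (x y : Fin n) :
    (↑T : Set (Sym2 (Fin n))) ∈ (openConn x y : Set (BondConfig (Fin n))) ↔
      (SimpleGraph.fromEdgeSet (↑T : Set (Sym2 (Fin n)))).Reachable x y := Iff.rfl

/-- The gluing-defect event `{o ↔ A} ∩ {o ↮ b}` read on `↑T` as a decidable predicate. -/
theorem coe_mem_gluingDefect_iff {n : ℕ} (T : Finset (Sym2 (Fin n))) (A : Finset (Fin n)) (o b : Fin n) :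
    (↑T : Set (Sym2 (Fin n))) ∈ ((⋃ a ∈ A, openConn o a) ∩ (openConn o b)ᶜ : Set (BondConfig (Fin n))) ↔
      (∃ a ∈ A, (SimpleGraph.fromEdgeSet (↑T : Set (Sym2 (Fin n)))).Reachable o a) ∧
        ¬ (SimpleGraph.fromEdgeSet (↑T : Set (Sym2 (Fin n)))).Reachable o b := by
  simp only [Set.mem_inter_iff, Set.mem_iUnion, Set.mem_compl_iff, exists_prop, coe_mem_openConn_iff]

/-- The cut event `{x ↮ y}` read on `↑T`. -/
theorem coe_mem_compl_openConn_iff {n : ℕ} (T : Finset (Sym2 (Fin n))) (x y : Fin n) :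
    (↑T : Set (Sym2 (Fin n))) ∈ ((openConn x y)ᶜ : Set (BondConfig (Fin n))) ↔
      ¬ (SimpleGraph.fromEdgeSet (↑T : Set (Sym2 (Fin n)))).Reachable x y := by
  rw [Set.mem_compl_iff, coe_mem_openConn_iff]

/-- The event `{o ↮ A}` read on `↑T`. -/
theorem coe_mem_compl_iUnion_openConn_iff {n : ℕ} (T : Finset (Sym2 (Fin n))) (A : Finset (Fin n)) (o : Fin n) :
    (↑T : Set (Sym2 (Fin n))) ∈ ((⋃ a ∈ A, openConn o a)ᶜ : Set (BondConfig (Fin n))) ↔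
      ¬ ∃ a ∈ A, (SimpleGraph.fromEdgeSet (↑T : Set (Sym2 (Fin n)))).Reachable o a := by
  simp only [Set.mem_compl_iff, Set.mem_iUnion, exists_prop, coe_mem_openConn_iff]

open Classical in
/-- The captured count `N(↑T) = |{a ∈ A : o ↔ a}|` read as a decidable filter. -/
theorem filter_coe_mem_openConn_eq {n : ℕ} (T : Finset (Sym2 (Fin n))) (A : Finset (Fin n)) (o : Fin n) :
    (A.filter fun a => (↑T : Set (Sym2 (Fin n))) ∈ (openConn o a : Set (BondConfig (Fin n)))) =
      A.filter fun a => (SimpleGraph.fromEdgeSet (↑T : Set (Sym2 (Fin n)))).Reachable o a := by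
  ext a
  simp only [Finset.mem_filter, coe_mem_openConn_iff]

/-! ### The integer certificates (`n = 4`, all loopless edge sets; computational facts, `native_decide`) -/

/-- **AG count certificate.** For every loopless `E ⊆ Sym2 (Fin 4)`, nonempty `A`, and `o, b`:
some `a ∈ A` has `#{T ⊆ E : o ↔ A, o ↮ b} ≤ #{T ⊆ E : a ↮ b}`. (64 graphs × 16 × 16 instances; the exact sweep
(kit compute job j018359) gives the sharp ratio `3/4` on this window.) [folklore] -/
theorem agCount_fin4 :
    ∀ E : Finset (Sym2 (Fin 4)), (∀ e ∈ E, ¬ e.IsDiag) →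
      ∀ (A : Finset (Fin 4)) (o b : Fin 4), A.Nonempty →
        ∃ a ∈ A,
          (E.powerset.filter fun T : Finset (Sym2 (Fin 4)) =>
              (∃ a' ∈ A, (SimpleGraph.fromEdgeSet (↑T : Set (Sym2 (Fin 4)))).Reachable o a') ∧
                ¬ (SimpleGraph.fromEdgeSet (↑T : Set (Sym2 (Fin 4)))).Reachable o b).card ≤
            (E.powerset.filter fun T : Finset (Sym2 (Fin 4)) =>
              ¬ (SimpleGraph.fromEdgeSet (↑T : Set (Sym2 (Fin 4)))).Reachable a b).card := by
  native_decide

/-- **LIN count certificate (linear lower tail, `C = 1`).** For every loopless `E`, every `A` with `2 ≤ |A|`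
and `o ∉ A`: `#{T : 1 ≤ N, 2N ≤ |A|} ≤ #{T : o ↮ A} + #{T : a ↮ a'}` for some `a, a' ∈ A`,
`N = |{a ∈ A : o ↔ a}|`. (Sweep (kit compute job j018359): sharp ratio `4/7` on this window.) [folklore] -/
theorem lowerTailCount_fin4 :
    ∀ E : Finset (Sym2 (Fin 4)), (∀ e ∈ E, ¬ e.IsDiag) →
      ∀ (A : Finset (Fin 4)) (o : Fin 4), 2 ≤ A.card → o ∉ A →
        ∃ a ∈ A, ∃ a' ∈ A,
          (E.powerset.filter fun T : Finset (Sym2 (Fin 4)) =>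
              1 ≤ (A.filter fun a => (SimpleGraph.fromEdgeSet (↑T : Set (Sym2 (Fin 4)))).Reachable o a).card ∧
                2 * (A.filter fun a => (SimpleGraph.fromEdgeSet (↑T : Set (Sym2 (Fin 4)))).Reachable o a).card ≤
                  A.card).card ≤
            (E.powerset.filter fun T : Finset (Sym2 (Fin 4)) =>
                ¬ ∃ a ∈ A, (SimpleGraph.fromEdgeSet (↑T : Set (Sym2 (Fin 4)))).Reachable o a).card +
              (E.powerset.filter fun T : Finset (Sym2 (Fin 4)) =>
                ¬ (SimpleGraph.fromEdgeSet (↑T : Set (Sym2 (Fin 4)))).Reachable a a').card := by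
  native_decide

/-- **HUB count certificate.** For every loopless `E`, every `A`, hub `a₀ ∈ A` and `o ∉ A`:
`#{T : o ↮ a₀, 1 ≤ N', 2N' ≤ |A|} ≤ #{T : a ↮ a₀}` for some `a ∈ A`, `N' = |{a ∈ A ∖ a₀ : o ↔ a}|`.
(Sweep (kit compute job j018359): sharp ratio `5/8` on this window.) [folklore] -/
theorem hubTailCount_fin4 :
    ∀ E : Finset (Sym2 (Fin 4)), (∀ e ∈ E, ¬ e.IsDiag) →
      ∀ (A : Finset (Fin 4)) (o a₀ : Fin 4), a₀ ∈ A → o ∉ A →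
        ∃ a ∈ A,
          (E.powerset.filter fun T : Finset (Sym2 (Fin 4)) =>
              ¬ (SimpleGraph.fromEdgeSet (↑T : Set (Sym2 (Fin 4)))).Reachable o a₀ ∧
              1 ≤ ((A.erase a₀).filter fun a =>
                    (SimpleGraph.fromEdgeSet (↑T : Set (Sym2 (Fin 4)))).Reachable o a).card ∧
                2 * ((A.erase a₀).filter fun a =>
                    (SimpleGraph.fromEdgeSet (↑T : Set (Sym2 (Fin 4)))).Reachable o a).card ≤ A.card).card ≤
            (E.powerset.filter fun T : Finset (Sym2 (Fin 4)) =>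
              ¬ (SimpleGraph.fromEdgeSet (↑T : Set (Sym2 (Fin 4)))).Reachable a a₀).card := by
  native_decide

/-! ### Measure-level statements on the window -/

/-- Monotonicity of the counting normal form in the count. -/
theorem card_div_le_card_div {a b : ℕ} (h : a ≤ b) (m : ℕ) :
    (a : ℝ) / 2 ^ m ≤ (b : ℝ) / 2 ^ m :=
  div_le_div_of_nonneg_right (by exact_mod_cast h) (by positivity)

/-- **Gluing defect ≤ worst relay cut** on the window (instance-wise `AdditiveGluing`): for every loopless
`E ⊆ Sym2 (Fin 4)` with weight `1/2`, nonempty `A`, `o`, `b`, some relay `a ∈ A` has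
`P(o ↔ A, o ↮ b) ≤ P(a ↮ b)`. [folklore] -/
theorem gluingDefect_le_fin4 (E : Finset (Sym2 (Fin 4))) (hE : ∀ e ∈ E, ¬ e.IsDiag)
    (A : Finset (Fin 4)) (o b : Fin 4) (hA : A.Nonempty) :
    ∃ a ∈ A,
      (prodBernoulli (fun e => if e ∈ E then half else 0 : Sym2 (Fin 4) → unitInterval)).real
          ((⋃ a' ∈ A, openConn o a') ∩ (openConn o b)ᶜ) ≤
        (prodBernoulli (fun e => if e ∈ E then half else 0 : Sym2 (Fin 4) → unitInterval)).real
          (openConn a b)ᶜ := by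
  obtain ⟨a, ha, h⟩ := agCount_fin4 E hE A o b hA
  refine ⟨a, ha, ?_⟩
  rw [real_halfOn_eq_card_div' E _ _ (fun T => coe_mem_gluingDefect_iff T A o b),
    real_halfOn_eq_card_div' E _ _ (fun T => coe_mem_compl_openConn_iff T a b)]
  exact card_div_le_card_div h E.card

/-- **The route's `AdditiveGluing` (item stmt-CriticalPhenomena-4576) holds VERBATIM on the window**
`n = 4`, `w = (1/2)·1_E`, `E` loopless: `0 ≤ t → (∀ a ∈ A, 1 − t ≤ P(a ↔ b)) → P(o ↔ A) − t ≤ P(o ↔ b)`. [folklore] -/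
theorem additiveGluing_fin4 (E : Finset (Sym2 (Fin 4))) (hE : ∀ e ∈ E, ¬ e.IsDiag)
    (A : Finset (Fin 4)) (o b : Fin 4) (t : ℝ) (ht : 0 ≤ t)
    (hrel : ∀ a ∈ A, 1 - t ≤
      (prodBernoulli (fun e => if e ∈ E then half else 0 : Sym2 (Fin 4) → unitInterval)).real (openConn a b)) :
    (prodBernoulli (fun e => if e ∈ E then half else 0 : Sym2 (Fin 4) → unitInterval)).real
        (⋃ a ∈ A, openConn o a) - t ≤
      (prodBernoulli (fun e => if e ∈ E then half else 0 : Sym2 (Fin 4) → unitInterval)).real (openConn o b) := by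
  set μ := prodBernoulli (fun e => if e ∈ E then half else 0 : Sym2 (Fin 4) → unitInterval) with hμ
  rcases A.eq_empty_or_nonempty with hA | hA
  · subst hA
    simp only [Finset.notMem_empty, Set.iUnion_of_empty, Set.iUnion_empty, measureReal_empty, zero_sub]
    exact (neg_nonpos.2 ht).trans measureReal_nonneg
  obtain ⟨a, ha, hglue⟩ := gluingDefect_le_fin4 E hE A o b hA
  have hmeasB : MeasurableSet (openConn o b : Set (BondConfig (Fin 4))) := measurableSet_openConn_holds o b
  have hcut : μ.real (openConn a b)ᶜ ≤ t := by
    have h1 := hrel a ha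
    have h2 : μ.real (openConn a b)ᶜ = 1 - μ.real (openConn a b) :=
      probReal_compl_eq_one_sub (measurableSet_openConn_holds a b)
    linarith
  have hsplit : μ.real (⋃ a ∈ A, openConn o a) ≤
      μ.real (openConn o b) + μ.real ((⋃ a ∈ A, openConn o a) ∩ (openConn o b)ᶜ) := by
    calc μ.real (⋃ a ∈ A, openConn o a)
        = μ.real ((⋃ a ∈ A, openConn o a) ∩ openConn o b ∪ (⋃ a ∈ A, openConn o a) ∩ (openConn o b)ᶜ) := by
          rw [Set.inter_union_compl]
      _ ≤ μ.real ((⋃ a ∈ A, openConn o a) ∩ openConn o b) + μ.real ((⋃ a ∈ A, openConn o a) ∩ (openConn o b)ᶜ) :=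
          measureReal_union_le _ _
      _ ≤ μ.real (openConn o b) + μ.real ((⋃ a ∈ A, openConn o a) ∩ (openConn o b)ᶜ) := by
          gcongr
          · exact measure_ne_top _ _
          · exact Set.inter_subset_right
  linarith

open Classical in
/-- **Linear lower tail with constant `1` on the window.** For every loopless `E ⊆ Sym2 (Fin 4)` at weight
`1/2`, every relay set `A` with `2 ≤ |A|` and observer `o ∉ A`, with `N(ω) = |{a ∈ A : o ↔ a}|`:
`P(1 ≤ N, 2N ≤ |A|) ≤ P(o ↮ A) + P(a ↮ a')` for some `a, a' ∈ A` (a fortiori `≤ P(o ↮ A) + max_{a,a'} P(a ↮ a')`,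
the planner's linear form of the crux with `C = 1` at threshold `|A|/2`). [folklore] -/
theorem lowerTail_le_fin4 (E : Finset (Sym2 (Fin 4))) (hE : ∀ e ∈ E, ¬ e.IsDiag)
    (A : Finset (Fin 4)) (o : Fin 4) (hA : 2 ≤ A.card) (ho : o ∉ A) :
    ∃ a ∈ A, ∃ a' ∈ A,
      (prodBernoulli (fun e => if e ∈ E then half else 0 : Sym2 (Fin 4) → unitInterval)).real
          {ω | 1 ≤ (A.filter fun a => ω ∈ openConn o a).card ∧
            2 * (A.filter fun a => ω ∈ openConn o a).card ≤ A.card} ≤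
        (prodBernoulli (fun e => if e ∈ E then half else 0 : Sym2 (Fin 4) → unitInterval)).real
            (⋃ a ∈ A, openConn o a)ᶜ +
          (prodBernoulli (fun e => if e ∈ E then half else 0 : Sym2 (Fin 4) → unitInterval)).real
            (openConn a a')ᶜ := by
  obtain ⟨a, ha, a', ha', h⟩ := lowerTailCount_fin4 E hE A o hA ho
  refine ⟨a, ha, a', ha', ?_⟩
  have hP : ∀ T : Finset (Sym2 (Fin 4)),
      (↑T : Set (Sym2 (Fin 4))) ∈ {ω : BondConfig (Fin 4) | 1 ≤ (A.filter fun a => ω ∈ openConn o a).card ∧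
          2 * (A.filter fun a => ω ∈ openConn o a).card ≤ A.card} ↔
        1 ≤ (A.filter fun a => (SimpleGraph.fromEdgeSet (↑T : Set (Sym2 (Fin 4)))).Reachable o a).card ∧
          2 * (A.filter fun a => (SimpleGraph.fromEdgeSet (↑T : Set (Sym2 (Fin 4)))).Reachable o a).card ≤
            A.card := by
    intro T
    simp only [Set.mem_setOf_eq, filter_coe_mem_openConn_eq]
  rw [real_halfOn_eq_card_div' E _ _ hP,
    real_halfOn_eq_card_div' E _ _ (fun T => coe_mem_compl_iUnion_openConn_iff T A o),
    real_halfOn_eq_card_div' E _ _ (fun T => coe_mem_compl_openConn_iff T a a'), ← add_div, ← Nat.cast_add]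
  exact card_div_le_card_div h E.card

open Classical in
/-- **Hub lower tail on the window.** For every loopless `E ⊆ Sym2 (Fin 4)` at weight `1/2`, relay set `A`,
hub `a₀ ∈ A` and observer `o ∉ A`, with `N'(ω) = |{a ∈ A ∖ a₀ : o ↔ a}|`:
`P(o ↮ a₀, 1 ≤ N', 2N' ≤ |A|) ≤ P(a ↮ a₀)` for some `a ∈ A` (lead-0's hub ratio `R₁ ≤ 1`). [folklore] -/
theorem hubTail_le_fin4 (E : Finset (Sym2 (Fin 4))) (hE : ∀ e ∈ E, ¬ e.IsDiag)
    (A : Finset (Fin 4)) (o a₀ : Fin 4) (ha₀ : a₀ ∈ A) (ho : o ∉ A) :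
    ∃ a ∈ A,
      (prodBernoulli (fun e => if e ∈ E then half else 0 : Sym2 (Fin 4) → unitInterval)).real
          {ω | ω ∉ openConn o a₀ ∧ 1 ≤ ((A.erase a₀).filter fun a => ω ∈ openConn o a).card ∧
            2 * ((A.erase a₀).filter fun a => ω ∈ openConn o a).card ≤ A.card} ≤
        (prodBernoulli (fun e => if e ∈ E then half else 0 : Sym2 (Fin 4) → unitInterval)).real
          (openConn a a₀)ᶜ := by
  obtain ⟨a, ha, h⟩ := hubTailCount_fin4 E hE A o a₀ ha₀ ho
  refine ⟨a, ha, ?_⟩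
  have hP : ∀ T : Finset (Sym2 (Fin 4)),
      (↑T : Set (Sym2 (Fin 4))) ∈ {ω : BondConfig (Fin 4) | ω ∉ openConn o a₀ ∧
          1 ≤ ((A.erase a₀).filter fun a => ω ∈ openConn o a).card ∧
            2 * ((A.erase a₀).filter fun a => ω ∈ openConn o a).card ≤ A.card} ↔
        ¬ (SimpleGraph.fromEdgeSet (↑T : Set (Sym2 (Fin 4)))).Reachable o a₀ ∧
          1 ≤ ((A.erase a₀).filter fun a => (SimpleGraph.fromEdgeSet (↑T : Set (Sym2 (Fin 4)))).Reachable o a).card ∧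
            2 * ((A.erase a₀).filter fun a =>
              (SimpleGraph.fromEdgeSet (↑T : Set (Sym2 (Fin 4)))).Reachable o a).card ≤ A.card := by
    intro T
    simp only [Set.mem_setOf_eq, coe_mem_openConn_iff]
  rw [real_halfOn_eq_card_div' E _ _ hP,
    real_halfOn_eq_card_div' E _ _ (fun T => coe_mem_compl_openConn_iff T a a₀)]
  exact card_div_le_card_div h E.card

end Summit.CriticalPhenomena.PercolationContinuityZ3.Theorems.NoHeavyLowerTail.Negative
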